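import Summits.ResolutionOfSingularities.ResolutionOfSingularities.Theorems.EquisingularLiftEquisingularLiftNatPlaneChartLocalization
import HarnessLib

/-!
# [OURS · L1 W4.5(b) · EL♮(3)] B7★ / (δ) — plane chart localisation, POINTED form: regularity of the strict transform in a model of the
# carrier's blow-up chart from regularity of `(Λ[X,Y]/(Φ_j))_Q` at the primes `Q` over the point only
# (crux `EquisingularLiftNatThree` stmt-ResolutionOfSingularities-20148 / parent 20038; rungs v7 TC⁺ / v7′ TC⁺⁺)

NOT a statement of any manuscript. Helper file of the chain res-L1-w45b (cell `res-hironaka`, LADDER-RESOLUTION rung L, slot W4.5(b));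
OURS; AI-written, weaker than expert review; `--supports stmt-ResolutionOfSingularities-20148 --as helper` by res-L1-w45b-stub-3. No `sorry`;
standard axioms. It closes nothing by itself.

WHAT. Part 1 (…NatPlaneChartLocalization, p537908) proves `isRegularLocalRing_quot_of_planeChart` under the hypothesis that
`(Λ[X,Y]/(Φ_j))_Q` is regular at EVERY prime `Q ∋ C ϖ` — the output shape of res-L1-w45b-stub-1's T-ΔLIFT-CENTRED (p523916) at the
cone point of the TC⁺ rung. At a general point `a_t` of a CLUSTER (rung v7′ TC⁺⁺; res-L1-w45b-stub-3's part 9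
`Sections.exists_isHomogeneous_clusterLift_deltaRegular_stCharts`, p531761) regularity is only granted off finitely many primes lying over
the OTHER cluster points, so the consumer needs the pointed form proved here:

* **`isRegularLocalRing_quot_of_planeChart_over`** — same conclusion, hypothesis restricted to the primes `Q` with `κ_j⁻¹(Q̃) = 𝔫`
  (`Q̃` the preimage of `Q` in `Λ[X,Y]`): the prime `P = β_j⁻¹(𝔮)` at which a model of `B̄_𝔮` is `Λ[X,Y]_P` satisfies
  `κ_j⁻¹(P) = ψ⁻¹(𝔪_{A₀}) = 𝔫` because `β_j ∘ κ_j = (A₀ → B̄) ∘ ψ` and `𝔮 ∩ A₀ = 𝔪_{A₀}`.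

References: U. Görtz, T. Wedhorn, *Algebraic Geometry I* (2020), Prop. 13.96 (2) p. 416 [cite: GortzWedhorn2020]. Tree inputs: part 1
(p537908), res-type-100 `isRegularLocalRing_quotient_map_of_isLocalization` (…NatCarrierDeltaRegular).
-/

set_option linter.dupNamespace false -- mandated namespace `Summit.<Summit>.<Problem>` of this single-conjunct summit

noncomputable section

namespace Summit.ResolutionOfSingularities.ResolutionOfSingularities.Cruxes.EquisingularLiftNat.Sections.TCPlus

open MvPolynomial IsLocalRing Literature.AlgebraicGeometry.Resolution
open Summit.ResolutionOfSingularities.ResolutionOfSingularities.Cruxes.EquisingularLiftNat.Sections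

universe u

variable {Λ : Type u} [CommRing Λ] {A₀ : Type u} [CommRing A₀]
  (ψ : MvPolynomial (Fin 2) Λ →+* A₀) (𝔫 : Ideal (MvPolynomial (Fin 2) Λ)) [𝔫.IsPrime]
  (x : Fin 2 → A₀) (j' : Fin 2)

/-- **(H-model) on one chart, POINTED form** — as `isRegularLocalRing_quot_of_planeChart` (part 1), but the regularity of
`(Λ[X,Y]/(Φ_j))_Q` is only asked at the primes `Q` LYING OVER THE POINT `𝔫` of the `(U₁,U₂)`-plane, i.e. with
`κ_j⁻¹(Q) = 𝔫` for the chart substitution `κ_j : U_j ↦ X_j, U_l ↦ X_j·X_l` (these are the points of the exceptional curve of the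
chart over the centre; `C ϖ ∈ Q` follows when `C ϖ ∈ 𝔫`). This is the shape needed at a GENERAL point of a cluster (rung v7′ TC⁺⁺,
(δ)), where res-L1-w45b-stub-3's part 9 (p531761) grants regularity only off finitely many primes lying over OTHER points. Proof as in
part 1: every model `T` of `B̄_𝔮` is `Λ[X,Y]_P` with `P = β_j⁻¹(𝔮)`, and `κ_j⁻¹(P) = ψ⁻¹(𝔪_{A₀}) = 𝔫`.
[cite: GortzWedhorn2020, Prop. 13.96 (2) p. 416] [OURS · L1 W4.5b] B7★/(δ); NOT a statement of the manuscript. -/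
theorem isRegularLocalRing_quot_of_planeChart_over [IsDomain Λ] [IsLocalRing A₀]
    (hloc : @IsLocalization.AtPrime _ _ A₀ _ ψ.toAlgebra 𝔫 _)
    (hx : ∀ l, ψ (X l) = x l) {m : ℕ} (Φb : MvPolynomial (Fin 2) A₀) (hΦbd : Φb.IsHomogeneous m)
    (F Fj : MvPolynomial (Fin 2) Λ) (hF : MvPolynomial.eval x Φb = ψ F)
    (hFj : MvPolynomial.aeval (R := Λ) (fun l : Fin 2 => if l = j' then (X j' : MvPolynomial (Fin 2) Λ) else X j' * X l) F =
      X j' ^ m * Fj)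
    (hreg : ∀ (Q : Ideal (MvPolynomial (Fin 2) Λ ⧸ Ideal.span {Fj})) [Q.IsPrime],
      (Q.comap (Ideal.Quotient.mk (Ideal.span {Fj}))).comap
        (MvPolynomial.aeval (R := Λ) fun l : Fin 2 =>
          if l = j' then (X j' : MvPolynomial (Fin 2) Λ) else X j' * X l).toRingHom = 𝔫 →
      IsRegularLocalRing (Localization.AtPrime Q))
    (𝔮 : Ideal (blowupAlgebra (Ideal.span (Set.range x)) (x j'))) [𝔮.IsPrime]
    (h𝔮 : 𝔮.comap (algebraMap A₀ _) = maximalIdeal A₀)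
    (hmem : MvPolynomial.aeval (blowupAlgebra.frac x j') Φb ∈ 𝔮)
    (T : Type u) [CommRing T] [Algebra (blowupAlgebra (Ideal.span (Set.range x)) (x j')) T] [IsLocalization.AtPrime T 𝔮] :
    IsRegularLocalRing (T ⧸ Ideal.span {algebraMap _ T (MvPolynomial.aeval (blowupAlgebra.frac x j') Φb)}) := by
  classical
  set β := MvPolynomial.eval₂Hom
      ((algebraMap A₀ (blowupAlgebra (Ideal.span (Set.range x)) (x j'))).comp (ψ.comp MvPolynomial.C))
      (fun l => if l = j' then algebraMap A₀ (blowupAlgebra (Ideal.span (Set.range x)) (x j')) (x j')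
        else blowupAlgebra.frac x j' l) with hβ
  set κ := (MvPolynomial.aeval (R := Λ) fun l : Fin 2 => if l = j' then (X j' : MvPolynomial (Fin 2) Λ) else X j' * X l)
    with hκ
  have hψinj := planeChart_loc_injective ψ 𝔫 hloc
  haveI := planeChart_loc_isDomain ψ 𝔫 hloc
  have hxj : x j' ≠ 0 := by
    rw [← hx]
    exact fun h => MvPolynomial.X_ne_zero j' (hψinj (by rw [h, map_zero]))
  haveI : IsDomain (Localization.Away (x j')) :=
    IsLocalization.isDomain_localization (powers_le_nonZeroDivisors_of_noZeroDivisors hxj)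
  haveI : IsDomain (blowupAlgebra (Ideal.span (Set.range x)) (x j')) := Subalgebra.isDomain _
  have halg : Function.Injective (algebraMap A₀ (blowupAlgebra (Ideal.span (Set.range x)) (x j'))) := fun a b h => by
    have h' : (algebraMap A₀ (blowupAlgebra (Ideal.span (Set.range x)) (x j')) a : Localization.Away (x j')) =
        (algebraMap A₀ (blowupAlgebra (Ideal.span (Set.range x)) (x j')) b : Localization.Away (x j')) := by rw [h]
    rw [Subalgebra.coe_algebraMap, Subalgebra.coe_algebraMap] at h'
    exact IsLocalization.injective (Localization.Away (x j')) (powers_le_nonZeroDivisors_of_noZeroDivisors hxj) h'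
  have hβκ : ∀ f, β (κ f) = algebraMap A₀ (blowupAlgebra (Ideal.span (Set.range x)) (x j')) (ψ f) := fun f =>
    RingHom.congr_fun (planeChartHom_comp_subst ψ x j' hx) f
  -- `β_j(Φ_j) = Φ̄′(ū/ū_j)`
  have hβF : β Fj = MvPolynomial.aeval (blowupAlgebra.frac x j') Φb := by
    have h1 := algebraMap_eval_eq_pow_mul_coneTransform x j' hΦbd
    have h2 : algebraMap A₀ (blowupAlgebra (Ideal.span (Set.range x)) (x j')) (MvPolynomial.eval x Φb) =
        β (X j') ^ m * β Fj := by
      rw [hF, ← hβκ, ← map_pow, ← map_mul, ← hFj]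
    have h3 : β (X j') = algebraMap A₀ (blowupAlgebra (Ideal.span (Set.range x)) (x j')) (x j') := by
      rw [hβ, MvPolynomial.eval₂Hom_X', if_pos rfl]
    rw [h2, h3] at h1
    exact mul_left_cancel₀ (pow_ne_zero m fun h => hxj (halg (by rw [h, map_zero]))) h1
  -- `T` is the localisation of `Λ[X,Y]` at `P = β⁻¹(𝔮)`
  letI algB : Algebra (MvPolynomial (Fin 2) Λ) (blowupAlgebra (Ideal.span (Set.range x)) (x j')) := β.toAlgebra
  haveI : IsLocalization (Submonoid.map κ 𝔫.primeCompl) (blowupAlgebra (Ideal.span (Set.range x)) (x j')) :=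
    isLocalization_planeChart ψ 𝔫 x j' hloc hx
  letI algT : Algebra (MvPolynomial (Fin 2) Λ) T :=
    ((algebraMap (blowupAlgebra (Ideal.span (Set.range x)) (x j')) T).comp β).toAlgebra
  haveI : IsScalarTower (MvPolynomial (Fin 2) Λ) (blowupAlgebra (Ideal.span (Set.range x)) (x j')) T :=
    IsScalarTower.of_algebraMap_eq fun f => rfl
  haveI hT : IsLocalization.AtPrime T
      (𝔮.comap (algebraMap (MvPolynomial (Fin 2) Λ) (blowupAlgebra (Ideal.span (Set.range x)) (x j')))) :=
    IsLocalization.isLocalization_isLocalization_atPrime_isLocalization (Submonoid.map κ 𝔫.primeCompl) T 𝔮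
  have halgβ : algebraMap (MvPolynomial (Fin 2) Λ) (blowupAlgebra (Ideal.span (Set.range x)) (x j')) = β := rfl
  -- `Φ_j ∈ P`
  have hle : Ideal.span {Fj} ≤
      𝔮.comap (algebraMap (MvPolynomial (Fin 2) Λ) (blowupAlgebra (Ideal.span (Set.range x)) (x j'))) := by
    rw [Ideal.span_singleton_le_iff_mem, Ideal.mem_comap, halgβ, hβF]
    exact hmem
  haveI : ((𝔮.comap (algebraMap (MvPolynomial (Fin 2) Λ) (blowupAlgebra (Ideal.span (Set.range x)) (x j')))).map
      (Ideal.Quotient.mk (Ideal.span {Fj}))).IsPrime :=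
    Ideal.map_isPrime_of_surjective Ideal.Quotient.mk_surjective (by rw [Ideal.mk_ker]; exact hle)
  -- `P` lies over the point `𝔫`: `κ_j⁻¹(P) = 𝔫`
  have hP𝔫 : (((𝔮.comap (algebraMap (MvPolynomial (Fin 2) Λ) (blowupAlgebra (Ideal.span (Set.range x)) (x j')))).map
      (Ideal.Quotient.mk (Ideal.span {Fj}))).comap (Ideal.Quotient.mk (Ideal.span {Fj}))).comap κ.toRingHom = 𝔫 := by
    rw [Ideal.comap_map_of_surjective _ Ideal.Quotient.mk_surjective, ← RingHom.ker_eq_comap_bot, Ideal.mk_ker,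
      sup_eq_left.mpr hle]
    ext f
    rw [Ideal.mem_comap, Ideal.mem_comap, halgβ, AlgHom.toRingHom_eq_coe, RingHom.coe_coe, hβκ, ← Ideal.mem_comap, h𝔮]
    exact planeChart_loc_mem_maximalIdeal_iff ψ 𝔫 hloc f
  -- localisation commutes with quotients
  have key := isRegularLocalRing_quotient_map_of_isLocalization (S := T)
    (𝔮.comap (algebraMap (MvPolynomial (Fin 2) Λ) (blowupAlgebra (Ideal.span (Set.range x)) (x j'))))
    (Ideal.span {Fj}) hle (hreg _ hP𝔫)
  have hI : (Ideal.span {Fj}).map (algebraMap (MvPolynomial (Fin 2) Λ) T) =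
      Ideal.span {algebraMap (blowupAlgebra (Ideal.span (Set.range x)) (x j')) T
        (MvPolynomial.aeval (blowupAlgebra.frac x j') Φb)} := by
    rw [Ideal.map_span, Set.image_singleton, ← hβF]
    rfl
  rw [hI] at key
  exact key

end Summit.ResolutionOfSingularities.ResolutionOfSingularities.Cruxes.EquisingularLiftNat.Sections.TCPlus

end
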